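import Mathlib.AlgebraicGeometry.EllipticCurve.DivisionPolynomial.Basic
import Literature.NumberTheory.EllipticCurves.GoodReductionInertia
import HarnessLib

/-!
# From a rational point of order `3` to `y² + a₁xy + a₃y = x³`, and its reduction at `p ≠ 3`

Topic `NumberTheory/EllipticCurves`. Elementary algebra behind the Deuring normal form
(Silverman, *AEC*, App. A, Prop. 1.3 (PDF p. 356: `y² + αxy + y = x³`; proof: "we could find
appropriate substitutions") together with Exercise 3.9(a) (PDF p. 98: `[3]P = O` iff the tangent
line at `P` meets `E` only at `P`) — a point `P` of order `3` moved to `(0, 0)` with tangent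
`y = 0` gives `y² + a₁xy + a₃y = x³` — and the proof of Cor. A.1.4(a) (PDF pp. 356–357:
reduction of this form at residue characteristic `≠ 3`), arranged for the criterion of
Néron–Ogg–Shafarevich at a place of residue characteristic `≠ 3`
(`UnramifiedThreeTorsionGoodReduction`). We keep **two** parameters
`(a₁, a₃)` instead of Deuring's one (`α = a₁/∛a₃`), because the cube root `∛a₃` may generate a
*ramified* extension while `a₁, a₃` themselves are rational in the coordinates of the `3`-torsion
point.

Contents (theorems only; the curves are literal Weierstrass equations):

* `smul_eq_of_three_torsion`: if `P = (x₀, y₀)` lies on `W`, `λ` is the tangent slope at `P`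
  (`λ(2y₀ + a₁x₀ + a₃) = 3x₀² + 2a₂x₀ + a₄ - a₁y₀`) and `x(2P) = x₀` (i.e. `3P = O`:
  `λ² + a₁λ - a₂ - 3x₀ = 0`), then `⟨1, x₀, λ, y₀⟩ • W = ⟨a₁ + 2λ, 0, 2y₀ + a₁x₀ + a₃, 0, 0⟩`;
* `threeTorsionForm_c₄`, `threeTorsionForm_Δ`, `threeTorsionForm_b₈`, `eval_Ψ₃_threeTorsionForm`
  (`c₄ = a₁(a₁³ - 24a₃)`, `Δ = a₃³(a₁³ - 27a₃)`, `Ψ₃(x) = x(3x³ + a₁²x² + 3a₁a₃x + 3a₃²)`) and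
  `smul_threeTorsionForm` (rescaling by `u`: `(a₁, a₃) ↦ (a₁/u, a₃/u³)`);
* over a valued field `(F, w)` with `|3| = 1`:
  `val_pow_three_eq_of_eval_eq_zero` (if `|a₁|³ < |a₃|` then every root `x` of
  `3x³ + a₁²x² + 3a₁a₃x + 3a₃²` — the abscissa of a `3`-torsion point off the line `x = 0` — has
  `|x|³ = |a₃|²`, an ultrametric Newton-polygon computation),
  `isIntegral_threeTorsionForm` / `val_Δ_eq_one_or_one_lt_val_j` (`|a₁| ≤ 1 = |a₃|`: integral,
  and unit `Δ` or `|j| > 1`, Cases I–II of the proof of *AEC* A.1.4(a)) and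
  `one_lt_val_j_of_lt` (`|a₃| < |a₁|³`: `|j| = (|a₁|³/|a₃|)³ > 1`).

## References

* [SilvermanAEC2009] J. H. Silverman, *The Arithmetic of Elliptic Curves*, 2nd ed., GTM 106,
  Springer 2009: III.2.3 (group law), Exercise 3.7 (division polynomials, `ψ₃`), Exercise 3.9(a)
  (PDF p. 98), App. A Prop. 1.3 and proof of Cor. 1.4(a) (PDF pp. 356–357), Thm. VII.7.1.
-/

noncomputable section

open scoped NNReal

universe u

namespace Literature.NumberTheory.EllipticCurves

open _root_.WeierstrassCurve _root_.Polynomial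

/-! ## From a point of order `3` to `y² + a₁xy + a₃y = x³` -/

section ThreeTorsion

variable {F : Type u} [Field F]

/-- **A point of order `3` at the origin with horizontal tangent** (Silverman, *AEC*, App. A
Prop. 1.3, proof, with Exercise 3.9(a)). If `P = (x₀, y₀) ∈ W(F)`, `λ` satisfies the tangent-slope relation
`λ(2y₀ + a₁x₀ + a₃) = 3x₀² + 2a₂x₀ + a₄ - a₁y₀` and `λ² + a₁λ - a₂ - 3x₀ = 0` (which for the
tangent slope says `x(2P) = x₀`, i.e. `2P = ±P`, i.e. `3P = O` for `P` of order `≠ 2`), then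
the change of variables `x = x' + x₀`, `y = y' + λx' + y₀` gives `y² + a₁'xy + a₃'y = x³` with
`a₁' = a₁ + 2λ`, `a₃' = 2y₀ + a₁x₀ + a₃`.
[cite: SilvermanAEC2009, App. A, Prop. 1.3 (proof) and Exercise 3.9(a) (PDF pp. 356, 98)] -/
theorem smul_eq_of_three_torsion (W : WeierstrassCurve F) {x₀ y₀ la : F}
    (heq : W.toAffine.Equation x₀ y₀)
    (hla : la * (2 * y₀ + W.a₁ * x₀ + W.a₃) = 3 * x₀ ^ 2 + 2 * W.a₂ * x₀ + W.a₄ - W.a₁ * y₀)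
    (h3 : la ^ 2 + W.a₁ * la - W.a₂ - 3 * x₀ = 0) :
    (⟨1, x₀, la, y₀⟩ : VariableChange F) • W =
      ⟨W.a₁ + 2 * la, 0, 2 * y₀ + W.a₁ * x₀ + W.a₃, 0, 0⟩ := by
  rw [Affine.equation_iff] at heq
  ext
  · simp only [variableChange_a₁, Units.val_one, inv_one, one_mul]
  · simp only [variableChange_a₂, Units.val_one, inv_one, one_pow, one_mul]
    linear_combination -h3
  · simp only [variableChange_a₃, Units.val_one, inv_one, one_pow, one_mul]
    ring
  · simp only [variableChange_a₄, Units.val_one, inv_one, one_pow, one_mul]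
    linear_combination -hla
  · simp only [variableChange_a₆, Units.val_one, inv_one, one_pow, one_mul]
    linear_combination -heq

/-- `c₄ = a₁(a₁³ - 24a₃)` for `y² + a₁xy + a₃y = x³`. Silverman, *AEC*, A.1.3 (with two
parameters). [cite: SilvermanAEC2009, App. A, Prop. 1.3] -/
theorem threeTorsionForm_c₄ (p q : F) :
    (⟨p, 0, q, 0, 0⟩ : WeierstrassCurve F).c₄ = p * (p ^ 3 - 24 * q) := by
  simp only [c₄, b₂, b₄]; ring

/-- `Δ = a₃³(a₁³ - 27a₃)` for `y² + a₁xy + a₃y = x³`. Silverman, *AEC*, A.1.3 (with two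
parameters). [cite: SilvermanAEC2009, App. A, Prop. 1.3] -/
theorem threeTorsionForm_Δ (p q : F) :
    (⟨p, 0, q, 0, 0⟩ : WeierstrassCurve F).Δ = q ^ 3 * (p ^ 3 - 27 * q) := by
  simp only [Δ, b₂, b₄, b₆, b₈]; ring

/-- `Ψ₃(x) = x(3x³ + a₁²x² + 3a₁a₃x + 3a₃²)` for `y² + a₁xy + a₃y = x³` (`b₂ = a₁²`, `b₄ = a₁a₃`,
`b₆ = a₃²`, `b₈ = 0`). Silverman, *AEC*, Exercise 3.7. [cite: SilvermanAEC2009, Exercise III.3.7] -/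
theorem eval_Ψ₃_threeTorsionForm (p q x : F) :
    (⟨p, 0, q, 0, 0⟩ : WeierstrassCurve F).Ψ₃.eval x =
      x * (3 * x ^ 3 + p ^ 2 * x ^ 2 + 3 * (p * q) * x + 3 * q ^ 2) := by
  simp only [Ψ₃, b₂, b₄, b₆, b₈, eval_add, eval_mul, eval_C, eval_pow, eval_X, eval_ofNat]
  ring

/-- Rescaling `y² + a₁xy + a₃y = x³` by `u`: `(a₁, a₃) ↦ (a₁/u, a₃/u³)`. [folklore] -/
theorem smul_threeTorsionForm {m : F} (hm : m ≠ 0) (p q : F) :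
    (⟨Units.mk0 m hm, 0, 0, 0⟩ : VariableChange F) • (⟨p, 0, q, 0, 0⟩ : WeierstrassCurve F) =
      ⟨p / m, 0, q / m ^ 3, 0, 0⟩ := by
  ext
  · simp [variableChange_a₁, div_eq_inv_mul]
  · simp [variableChange_a₂]
  · simp [variableChange_a₃, div_eq_inv_mul]
  · simp [variableChange_a₄]
  · simp [variableChange_a₆]

end ThreeTorsion

/-! ## Valuations at a place with `|3| = 1` -/

section Valuation

variable {F : Type u} [Field F] {w : Valuation F ℝ≥0}

/-- **Abscissae of `3`-torsion points off `x = 0` when `|a₁|³ < |a₃|`** (Newton polygon of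
`3x³ + a₁²x² + 3a₁a₃x + 3a₃²` at a place with `|3| = 1`): every root `x` has `|x|³ = |a₃|²`, because
the two middle monomials are strictly smaller than `max (|3x³|, |3a₃²|)`. [folklore] -/
theorem val_pow_three_eq_of_eval_eq_zero (h3 : w (3 : F) = 1) {p q x : F} (hq : q ≠ 0)
    (hlt : w p ^ 3 < w q) (hx : 3 * x ^ 3 + p ^ 2 * x ^ 2 + 3 * (p * q) * x + 3 * q ^ 2 = 0) :
    w x ^ 3 = w q ^ 2 := by
  have hq0 : 0 < w q := (Valuation.pos_iff _).mpr hq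
  have hx0 : x ≠ 0 := by
    rintro rfl
    apply hq
    have : (3 : F) * q ^ 2 = 0 := by simpa using hx
    rcases mul_eq_zero.mp this with h | h
    · rw [h, map_zero] at h3; exact absurd h3 zero_ne_one
    · exact pow_eq_zero_iff two_ne_zero |>.mp h
  have hX0 : 0 < w x := (Valuation.pos_iff _).mpr hx0
  -- the four monomials
  have hT₁ : w (3 * x ^ 3) = w x ^ 3 := by rw [map_mul, h3, one_mul, map_pow]
  have hT₄ : w (3 * q ^ 2) = w q ^ 2 := by rw [map_mul, h3, one_mul, map_pow]
  have hT₂ : w (p ^ 2 * x ^ 2) = w p ^ 2 * w x ^ 2 := by rw [map_mul, map_pow, map_pow]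
  have hT₃ : w (3 * (p * q) * x) = w p * w q * w x := by
    rw [map_mul, map_mul, h3, one_mul, map_mul]
  -- the middle monomials are `< max (T₁, T₄)`
  have hmid₂ : w p ^ 2 * w x ^ 2 < max (w x ^ 3) (w q ^ 2) := by
    by_contra hle
    rw [not_lt, max_le_iff] at hle
    have h1 : w x ≤ w p ^ 2 := by
      have := hle.1
      rw [pow_succ' (w x) 2] at this
      exact le_of_mul_le_mul_right this (pow_pos hX0 2)
    have h2 : w q ≤ w p * w x := by
      have := hle.2
      rw [← mul_pow] at this
      exact le_of_pow_le_pow_left₀ two_ne_zero zero_le this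
    have : w q ≤ w p ^ 3 :=
      h2.trans (by rw [pow_succ']; exact mul_le_mul' le_rfl h1)
    exact absurd hlt (not_lt.mpr this)
  have hmid₃ : w p * w q * w x < max (w x ^ 3) (w q ^ 2) := by
    by_contra hle
    rw [not_lt, max_le_iff] at hle
    obtain ⟨hle1, hle2⟩ := hle
    have h1 : w x ^ 2 ≤ w p * w q := by
      rw [pow_succ] at hle1
      exact le_of_mul_le_mul_right hle1 hX0
    have h2 : w q ≤ w p * w x := by
      rw [sq, show w p * w q * w x = (w p * w x) * w q by ring] at hle2
      exact le_of_mul_le_mul_right hle2 hq0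
    have h3' : w x ≤ w p ^ 2 := by
      have : w x * w x ≤ w p ^ 2 * w x := by
        calc w x * w x = w x ^ 2 := (sq _).symm
          _ ≤ w p * w q := h1
          _ ≤ w p * (w p * w x) := mul_le_mul' le_rfl h2
          _ = w p ^ 2 * w x := by ring
      exact le_of_mul_le_mul_right this hX0
    have : w q ≤ w p ^ 3 :=
      h2.trans (by rw [pow_succ']; exact mul_le_mul' le_rfl h3')
    exact absurd hlt (not_lt.mpr this)
  -- hence the extreme monomials have the same valuation
  by_contra hne
  rcases lt_or_gt_of_ne hne with hlt' | hgt'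
  · -- `|3x³| < |3q²|`: the sum has valuation `|3q²| ≠ 0`
    have hmax : max (w x ^ 3) (w q ^ 2) = w q ^ 2 := max_eq_right hlt'.le
    rw [hmax] at hmid₂ hmid₃
    have hA : w (3 * x ^ 3 + p ^ 2 * x ^ 2 + 3 * (p * q) * x) < w (3 * q ^ 2) := by
      rw [hT₄]
      refine Valuation.map_add_lt _ (Valuation.map_add_lt _ ?_ ?_) ?_
      · rwa [hT₁]
      · rwa [hT₂]
      · rwa [hT₃]
    have := Valuation.map_add_eq_of_lt_left _ hA
    rw [add_comm, hx, map_zero, hT₄] at this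
    exact absurd this.symm (pow_ne_zero 2 hq0.ne')
  · -- `|3x³| > |3q²|`: the sum has valuation `|3x³| ≠ 0`
    have hmax : max (w x ^ 3) (w q ^ 2) = w x ^ 3 := max_eq_left hgt'.le
    rw [hmax] at hmid₂ hmid₃
    have hx' : 3 * x ^ 3 + (p ^ 2 * x ^ 2 + 3 * (p * q) * x + 3 * q ^ 2) = 0 := by
      linear_combination hx
    have hA : w (p ^ 2 * x ^ 2 + 3 * (p * q) * x + 3 * q ^ 2) < w (3 * x ^ 3) := by
      rw [hT₁]
      refine Valuation.map_add_lt _ (Valuation.map_add_lt _ ?_ ?_) ?_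
      · rwa [hT₂]
      · rwa [hT₃]
      · rwa [hT₄]
    have := Valuation.map_add_eq_of_lt_left _ hA
    rw [hx', map_zero, hT₁] at this
    exact absurd this.symm (pow_ne_zero 3 hX0.ne')

/-- `|n| ≤ 1` for every natural number `n` (any valuation on a field). [folklore] -/
theorem _root_.Valuation.map_natCast_le_one' {L : Type*} [Field L] {Γ₀ : Type*}
    [LinearOrderedCommGroupWithZero Γ₀] (w : Valuation L Γ₀) (n : ℕ) : w (n : L) ≤ 1 := by
  induction n with
  | zero => simp
  | succ n ih =>
    rw [Nat.cast_succ]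
    exact w.map_add_le ih (le_of_eq w.map_one)

/-- `|27| = 1` when `|3| = 1`. [folklore] -/
theorem val_twentyseven_eq_one (h3 : w (3 : F) = 1) : w (27 : F) = 1 := by
  rw [show (27 : F) = 3 ^ 3 by norm_num, map_pow, h3, one_pow]

/-- **`y² + a₁xy + a₃y = x³` with `|a₁| ≤ 1 = |a₃|` is integral** (`|3| = 1` not needed).
[cite: SilvermanAEC2009, App. A, proof of Cor. 1.4(a), Case I] -/
theorem isIntegral_threeTorsionForm {p q : F} (hp : w p ≤ 1) (hq : w q ≤ 1) :
    (⟨p, 0, q, 0, 0⟩ : WeierstrassCurve F).IsIntegral w.integer :=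
  isIntegral_integer_of_val_le_one hp (by simp) hq (by simp) (by simp)

/-- **Reduction of `y² + a₁xy + a₃y = x³` with `|a₁| ≤ 1 = |a₃|` at `|3| = 1`**: either
`Δ = a₃³(a₁³ - 27a₃)` is a unit (good reduction), or `|a₁³ - 27a₃| < 1`, and then `|a₁| = 1`,
`c₄ = a₁((a₁³ - 27a₃) + 3a₃)` is a unit and `|j| = 1/|Δ| > 1` (Cases I–II of the proof of
Silverman, *AEC*, Cor. A.1.4(a), with two parameters).
[cite: SilvermanAEC2009, App. A, proof of Cor. 1.4(a), Cases I–II (PDF pp. 356–357)] -/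
theorem val_Δ_eq_one_or_one_lt_val_j (h3 : w (3 : F) = 1) {p q : F} (hp : w p ≤ 1)
    (hq : w q = 1) [hE : (⟨p, 0, q, 0, 0⟩ : WeierstrassCurve F).IsElliptic] :
    w (⟨p, 0, q, 0, 0⟩ : WeierstrassCurve F).Δ = 1 ∨
      1 < w (⟨p, 0, q, 0, 0⟩ : WeierstrassCurve F).j := by
  have h27 := val_twentyseven_eq_one h3
  have hΔ : (⟨p, 0, q, 0, 0⟩ : WeierstrassCurve F).Δ = q ^ 3 * (p ^ 3 - 27 * q) :=
    threeTorsionForm_Δ p q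
  have hd : w (p ^ 3 - 27 * q) ≤ 1 := by
    refine Valuation.map_sub_le _ ?_ ?_
    · rw [map_pow]; exact pow_le_one₀ zero_le hp
    · rw [map_mul, h27, one_mul, hq]
  rcases hd.eq_or_lt with hd1 | hd1
  · left
    rw [hΔ, map_mul, map_pow, hq, one_pow, one_mul, hd1]
  · right
    have hΔ0 : (⟨p, 0, q, 0, 0⟩ : WeierstrassCurve F).Δ ≠ 0 := hE.isUnit.ne_zero
    have hwΔ : w (⟨p, 0, q, 0, 0⟩ : WeierstrassCurve F).Δ = w (p ^ 3 - 27 * q) := by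
      rw [hΔ, map_mul, map_pow, hq, one_pow, one_mul]
    -- `|a₁| = 1`: otherwise `|a₁³ - 27a₃| = |27a₃| = 1`
    have hp1 : w p = 1 := by
      refine hp.eq_or_lt.elim id fun hlt => ?_
      exfalso
      have h27q : w (p ^ 3) < w (27 * q) := by
        rw [map_mul, h27, hq, one_mul, map_pow]; exact pow_lt_one₀ zero_le hlt three_ne_zero
      have : w (p ^ 3 - 27 * q) = 1 := by
        rw [Valuation.map_sub_swap, Valuation.map_sub_eq_of_lt_left _ h27q, map_mul, h27, hq,
          one_mul]
      exact absurd this hd1.ne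
    have hc₄ : w (⟨p, 0, q, 0, 0⟩ : WeierstrassCurve F).c₄ = 1 := by
      rw [threeTorsionForm_c₄, show p ^ 3 - 24 * q = 3 * q + (p ^ 3 - 27 * q) by ring, map_mul,
        hp1, one_mul, Valuation.map_add_eq_of_lt_left _ ?_, map_mul, h3, hq, one_mul]
      rw [map_mul, h3, hq, one_mul]; exact hd1
    rw [j, map_mul, map_pow, Units.val_inv_eq_inv_val, map_inv₀, coe_Δ', hc₄, one_pow, mul_one,
      one_lt_inv_iff₀]
    exact ⟨(Valuation.pos_iff _).mpr hΔ0, by rw [hwΔ]; exact hd1⟩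

/-- **`|a₃| < |a₁|³` gives `|j| > 1`** for `y² + a₁xy + a₃y = x³` at `|3| = 1`:
`|c₄| = |a₁|⁴`, `|Δ| = |a₃|³|a₁|³`, `|j| = (|a₁|³/|a₃|)³` (Case III of the proof of Silverman,
*AEC*, Cor. A.1.4(a): `α ∉ R` gives multiplicative reduction after rescaling, in particular
non-integral `j`). [cite: SilvermanAEC2009, App. A, proof of Cor. 1.4(a), Case III] -/
theorem one_lt_val_j_of_lt (h3 : w (3 : F) = 1) {p q : F} (hq : q ≠ 0) (hlt : w q < w p ^ 3)
    [hE : (⟨p, 0, q, 0, 0⟩ : WeierstrassCurve F).IsElliptic] :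
    1 < w (⟨p, 0, q, 0, 0⟩ : WeierstrassCurve F).j := by
  have h27 := val_twentyseven_eq_one h3
  have hq0 : 0 < w q := (Valuation.pos_iff _).mpr hq
  have hp0 : 0 < w p := by
    refine pos_of_ne_zero fun h0 => ?_
    rw [h0, zero_pow three_ne_zero] at hlt
    exact absurd hlt (not_lt.mpr zero_le)
  have h24 : w (24 * q) < w (p ^ 3) := by
    rw [map_mul, map_pow]
    refine lt_of_le_of_lt (mul_le_of_le_one_left' ?_) hlt
    exact_mod_cast w.map_natCast_le_one' 24
  have h27q : w (27 * q) < w (p ^ 3) := by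
    rw [map_mul, h27, one_mul, map_pow]; exact hlt
  have hc₄ : w (⟨p, 0, q, 0, 0⟩ : WeierstrassCurve F).c₄ = w p ^ 4 := by
    rw [threeTorsionForm_c₄, map_mul, Valuation.map_sub_eq_of_lt_left _ h24, map_pow]; ring
  have hΔ : w (⟨p, 0, q, 0, 0⟩ : WeierstrassCurve F).Δ = w q ^ 3 * w p ^ 3 := by
    rw [threeTorsionForm_Δ, map_mul, map_pow, Valuation.map_sub_eq_of_lt_left _ h27q, map_pow]
  rw [j, map_mul, map_pow, Units.val_inv_eq_inv_val, map_inv₀, coe_Δ', hc₄, hΔ]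
  have hne : w q ≠ 0 := hq0.ne'
  have hne' : w p ≠ 0 := hp0.ne'
  rw [show (w q ^ 3 * w p ^ 3)⁻¹ * (w p ^ 4) ^ 3 = (w p ^ 3 / w q) ^ 3 by field_simp]
  exact one_lt_pow₀ ((one_lt_div hq0).mpr hlt) three_ne_zero

end Valuation

end Literature.NumberTheory.EllipticCurves

end
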